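import Mathlib
import Literature.NumberTheory.LFunctions.MertensTail
import HarnessLib

/-!
# `LiouvilleOrthogonalTC0` (stmt-QuantumAdvantage-1393), line `Sketch` — stub `stub_levelsA`

**Levels, analytic half.** Mertens' second theorem (tail form, the tree's PROVED
`Literature.NumberTheory.LFunctions.MertensBound.loglog_sub_loglog_le_sum_inv_prime`:
`∑_{P < p ≤ Q} 1/p ≥ log log Q - log log P - 6 / log P` for real `2 ≤ P ≤ Q`) in the shape the
level construction of the transfer needs: for a tower ratio `Λ ≥ 3 + κ` and exponents
`a ≥ a₀ > 0`, eventually in `n` (uniformly in `a`), every prime window `(P, Q]` with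
`e⁶ ≤ P ≤ 2^(n a (2+κ) + 2)` and `Q ≥ 2^(n Λ a - 1)` has `∑ 1/p ≥ log (Λ / (3+κ)) - 1`.

Proof: once `n a₀ ≥ 3` we have `n a (2+κ) + 2 ≤ n Λ a - 1` (so `P ≤ Q`),
`log P ≤ (n a (2+κ) + 2) log 2`, `log Q ≥ (n Λ a - 1) log 2` and
`(Λ / (3+κ)) (n a (2+κ) + 2) ≤ n Λ a - 1`, whence `log log Q - log log P ≥ log (Λ / (3+κ))`;
and `6 / log P ≤ 1` from `P ≥ e⁶`.

Theorem-only file, proved from the tree; no named facts are used.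
-/

set_option linter.dupNamespace false -- D-0017: single-problem summit ⇒ `QuantumAdvantage.QuantumAdvantage` by design

noncomputable section

namespace Summit.QuantumAdvantage.QuantumAdvantage.Theorems.LiouvilleOrthogonalTC0

open Filter Finset

/-- **Stub (levels, analytic half).** Mertens in the shape the level construction needs:
for `Λ ≥ 3 + κ` and exponents `a ≥ a₀ > 0`, eventually in `n` (uniformly in `a`), every prime
window `(P, Q]` with `e⁶ ≤ P ≤ 2^(n a (2+κ) + 2)` and `Q ≥ 2^(n Λ a - 1)` has
`Σ 1/p ≥ log(Λ/(3+κ)) - 1` (tree: `loglog_sub_loglog_le_sum_inv_prime`). -/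
theorem stub_levelsA (κ Λ a₀ : ℝ) (hκ : 0 < κ) (hΛ : 3 + κ ≤ Λ) (ha₀ : 0 < a₀) :
    ∀ᶠ n : ℕ in atTop, ∀ a : ℝ, a₀ ≤ a → ∀ P Q : ℕ, Real.exp 6 ≤ (P : ℝ) →
      (P : ℝ) ≤ (2 : ℝ) ^ ((n : ℝ) * a * (2 + κ) + 2) → (2 : ℝ) ^ ((n : ℝ) * Λ * a - 1) ≤ (Q : ℝ) →
      Real.log (Λ / (3 + κ)) - 1 ≤ ∑ p ∈ (Finset.Ioc P Q).filter Nat.Prime, (1 : ℝ) / p := by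
  filter_upwards [tendsto_natCast_atTop_atTop.eventually_ge_atTop (3 / a₀ : ℝ)] with n hn
  intro a ha P Q hP hPle hQ
  have hx : 3 ≤ (n : ℝ) * a := by
    rw [div_le_iff₀ ha₀] at hn
    have := mul_le_mul_of_nonneg_left ha (Nat.cast_nonneg n)
    linarith
  have h3κ : (0 : ℝ) < 3 + κ := by linarith
  have hΛ0 : 0 < Λ := by linarith
  have hlog2 : 0 < Real.log 2 := Real.log_pos one_lt_two
  -- `P ≥ 2`, `log P ≥ 6`
  have hP0 : (0 : ℝ) < P := (Real.exp_pos 6).trans_le hP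
  have hlogP : 6 ≤ Real.log P := by
    have := Real.log_le_log (Real.exp_pos 6) hP
    rwa [Real.log_exp] at this
  have hP2 : (2 : ℝ) ≤ P := by
    have := Real.add_one_le_exp (6 : ℝ)
    linarith
  -- `log P ≤ (n a (2+κ) + 2) log 2`
  have hlogP' : Real.log P ≤ ((n : ℝ) * a * (2 + κ) + 2) * Real.log 2 := by
    have := Real.log_le_log hP0 hPle
    rwa [Real.log_rpow two_pos] at this
  -- the exponents compare: `n a (2+κ) + 2 ≤ n Λ a - 1`, so `P ≤ Q`
  have hexp : (n : ℝ) * a * (2 + κ) + 2 ≤ (n : ℝ) * Λ * a - 1 := by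
    nlinarith [mul_nonneg (sub_nonneg.2 hx) (sub_nonneg.2 hΛ)]
  have hPQ : (P : ℝ) ≤ Q :=
    hPle.trans ((Real.rpow_le_rpow_of_exponent_le one_le_two hexp).trans hQ)
  -- `log Q ≥ (n Λ a - 1) log 2`
  have hlogQ : ((n : ℝ) * Λ * a - 1) * Real.log 2 ≤ Real.log Q := by
    have := Real.log_le_log (by positivity) hQ
    rwa [Real.log_rpow two_pos] at this
  -- Mertens
  have hM := Literature.NumberTheory.LFunctions.MertensBound.loglog_sub_loglog_le_sum_inv_prime
    hP2 hPQ
  rw [Nat.floor_natCast, Nat.floor_natCast] at hM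
  have h6 : 6 / Real.log P ≤ 1 := (div_le_one (by linarith)).mpr hlogP
  have hlogP0 : 0 < Real.log P := by linarith
  -- `(Λ / (3+κ)) log P ≤ log Q`
  have hkey : Λ / (3 + κ) * Real.log P ≤ Real.log Q := by
    have h1 : Λ / (3 + κ) * Real.log P ≤ Λ / (3 + κ) * (((n : ℝ) * a * (2 + κ) + 2) * Real.log 2) :=
      mul_le_mul_of_nonneg_left hlogP' (by positivity)
    have h2 : Λ / (3 + κ) * (((n : ℝ) * a * (2 + κ) + 2) * Real.log 2) ≤
        ((n : ℝ) * Λ * a - 1) * Real.log 2 := by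
      rw [div_mul_eq_mul_div, div_le_iff₀ h3κ]
      have : Λ * ((n : ℝ) * a * (2 + κ) + 2) ≤ ((n : ℝ) * Λ * a - 1) * (3 + κ) := by
        nlinarith [mul_nonneg (sub_nonneg.2 hx) hΛ0.le]
      nlinarith [mul_le_mul_of_nonneg_right this hlog2.le]
    linarith
  have hlog : Real.log (Λ / (3 + κ)) + Real.log (Real.log P) ≤ Real.log (Real.log Q) := by
    rw [← Real.log_mul (by positivity) hlogP0.ne']
    exact Real.log_le_log (by positivity) hkey
  linarith

end Summit.QuantumAdvantage.QuantumAdvantage.Theorems.LiouvilleOrthogonalTC0
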